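import Literature.NumberTheory.EllipticCurves.KubertTate289CubicLocalOdd
import Literature.NumberTheory.NumberFields.AdicCompletionDyadicDepth
import HarnessLib

/-!
# `E_{28/9}` over its cubic `2`-division field: the local condition of the `2`-isogeny descent at the dyadic
# place `𝔭₂ = (2, γ)` of degree one

Topic `NumberTheory/EllipticCurves`. Continuation of `KubertTate289CubicLocalOdd.lean`. At the prime `𝔭₂ = (2, γ)` of
`K = ℚ(γ)` (`γ³ - γ² + 27γ + 36 = 0`; `(2) = 𝔭₂ 𝔮₂`, `f(𝔭₂|2) = 1`, so `K_{𝔭₂} = ℚ₂` and `2` is a uniformiser) the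
curve `X = E_{A,B}` (`A = 76 - 228γ - 219δ ≡ -2 (mod 𝔭₂⁴)`, `B ≡ 1 (mod 𝔭₂³)`, `A² - 4B = B' ∈ 𝔭₂¹⁸`) satisfies the
hypotheses of the tree's dyadic lemma `WeierstrassCurve.xSqClass_eq_sqClass_one_add_eight_mul`: the `2`-isogeny Kummer
image `α(X(K_{𝔭₂}))` lies in `(1 + 8 O) K_vˣ²`. Combined with the depth-`N` density of `𝓞 K` in `O_{𝔭₂}`
(`AdicCompletionDyadicDepth`) this gives the arithmetic kill criterion of the `φ̂`-side at `𝔭₂`: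

* §1 `log_valuation_p2_two` — `ord_{𝔭₂}(2) = 1`; `mem_p2_pow_of_residue` — membership in `𝔭₂^k` from the `2`-adic
  residue maps `𝓞 K → ℤ/2^k` (`CubicField14483Ideals.exists_residueHom_two_pow`, `ker_eq_pow_p2`).
* §2 `exists_sq_congr_p2_of_local` — **if `d ∈ 𝓞 K` has `[d]_{𝔭₂} ∈ α(X(K_{𝔭₂}))` then
  `d a² ≡ 4^j (1 + 8 b) (mod 𝔭₂^N)`** for some `j`, `a ∉ 𝔭₂`, `b`.
* §3 `val_mod_p2_of_local` — **read through `ψ : 𝓞 K → ℤ/2^N` (`γ ↦ r`, `f(r) ≡ 0`, `r` even):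
  `ψ(d) ≡ 4^j (mod 2^{min(2j+3,N)})` for some `j`** — a decidable condition on `ψ(d)`.

Theorems only; no named facts.

## References
* [SilvermanAEC2009] J. H. Silverman, *The Arithmetic of Elliptic Curves*, 2nd ed. (2009), Prop. X.4.9, Ex. X.4.10.
* [Marcus2018] D. A. Marcus, *Number Fields*, 2nd ed. (2018), Ch. 3 Thm. 22, 27.
-/

noncomputable section

open scoped Classical NumberField
open Polynomial Module NumberField Ideal IsDedekindDomain

namespace Literature.NumberTheory.EllipticCurves

namespace KubertTate289Cubic

open _root_.WeierstrassCurve _root_.WeierstrassCurve.Affine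
open Literature.NumberTheory.NumberFields Literature.NumberTheory.NumberFields.MonicCubic
open Literature.NumberTheory.NumberFields.CubicField14483

variable {K : Type*} [Field K] [NumberField K] {γ : K}

/-! ## §1 `𝔭₂`: `ord(2) = 1`, residue maps to `ℤ/2^k`, and the congruences of `A`, `B`, `B'` -/

/-- **`ord_{𝔭₂}(2) = 1`**: `2 ∈ 𝔭₂` and `2 ∉ 𝔭₂²` (else `𝔭₂² ∣ (2) = 𝔭₂ 𝔮₂` would force `𝔭₂ = 𝔮₂`, of norms
`2 ≠ 4`). [cite: Marcus2018, Ch. 3, Thm. 22] -/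
theorem log_valuation_p2_two (hγ : γ ^ 3 - γ ^ 2 + 27 * γ + 36 = 0) (h3 : finrank ℚ K = 3) (ψ₁ : 𝓞 K →+* ZMod 2)
    (v : HeightOneSpectrum (𝓞 K)) (hv : RingHom.ker ψ₁ = v.asIdeal) :
    v.valuation K (2 : K) = WithZero.exp (-1) := by
  obtain ⟨hQ, hNQ⟩ := q2_mem_primesOver hγ h3
  have h20 : (2 : 𝓞 K) ≠ 0 := two_ne_zero
  have hfac := span_two_eq hγ h3 ψ₁
  have hmem : (2 : 𝓞 K) ∈ v.asIdeal ^ 1 := by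
    rw [pow_one, ← hv]; exact_mod_cast natCast_mem_ker_zmod ψ₁
  have hnot : (2 : 𝓞 K) ∉ v.asIdeal ^ 2 := by
    intro h2
    have hdvd : v.asIdeal ^ 2 ∣ span {((2 : ℕ) : 𝓞 K)} := Ideal.dvd_span_singleton.mpr (by exact_mod_cast h2)
    rw [hfac, hv, pow_two] at hdvd
    have hdvd' : v.asIdeal ∣ span {((2 : ℕ) : 𝓞 K), thetaInt (aeval_eq hγ) ^ 2 + ((1 : ℤ) : 𝓞 K) *
        thetaInt (aeval_eq hγ) + ((1 : ℤ) : 𝓞 K)} := (mul_dvd_mul_iff_left v.ne_bot).mp hdvd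
    haveI := hQ.1
    have hQmax := Ring.DimensionLEOne.maximalOfPrime (by
      intro hbot; rw [hbot, Ideal.absNorm_bot] at hNQ; exact absurd hNQ (by norm_num)) hQ.1
    have heq := (hQmax.eq_of_le v.isPrime.ne_top (Ideal.le_of_dvd hdvd')).symm
    have hN := congrArg Ideal.absNorm heq
    rw [← hv, absNorm_ker_zmod, hNQ] at hN
    norm_num at hN
  have h2K : (2 : K) = ((2 : 𝓞 K) : K) := rfl
  rw [h2K]
  have h1 := (mem_pow_iff_log_valuation_le v h20 1).mp hmem
  have h2 : ¬ WithZero.log (v.valuation K ((2 : 𝓞 K) : K)) ≤ -((2 : ℕ) : ℤ) :=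
    fun h => hnot ((mem_pow_iff_log_valuation_le v h20 2).mpr h)
  have hne : v.valuation K ((2 : 𝓞 K) : K) ≠ 0 :=
    (Valuation.ne_zero_iff _).mpr (by exact_mod_cast h20)
  rw [← WithZero.exp_log hne]
  congr 1
  push_cast at h1 h2
  omega

/-- From membership in `𝔭₂^k` to the valuation bound `v(x) ≤ v(2)^k = v(2^k)` in `K_v`. [cite: Marcus2018, Ch. 3, Thm. 22] -/
theorem valued_le_of_mem_p2_pow (hγ : γ ^ 3 - γ ^ 2 + 27 * γ + 36 = 0) (h3 : finrank ℚ K = 3)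
    (ψ₁ : 𝓞 K →+* ZMod 2) (v : HeightOneSpectrum (𝓞 K)) (hv : RingHom.ker ψ₁ = v.asIdeal) {k : ℕ} {x : 𝓞 K}
    (hx : x ∈ v.asIdeal ^ k) :
    Valued.v (algebraMap K (v.adicCompletion K) (x : K)) ≤ Valued.v ((2 : v.adicCompletion K) ^ k) := by
  have hval : ∀ y : K, Valued.v (algebraMap K (v.adicCompletion K) y) = v.valuation K y := fun y =>
    HeightOneSpectrum.valuedAdicCompletion_eq_valuation' v y
  rw [map_pow, ← map_ofNat (algebraMap K (v.adicCompletion K)) 2, hval, hval, log_valuation_p2_two hγ h3 ψ₁ v hv,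
    ← WithZero.exp_nsmul]
  by_cases hx0 : x = 0
  · rw [hx0]; simp
  have h := (mem_pow_iff_log_valuation_le v hx0 k).mp hx
  have hne : v.valuation K (x : K) ≠ 0 := (Valuation.ne_zero_iff _).mpr (by exact_mod_cast hx0)
  rw [← WithZero.exp_log hne, WithZero.exp_le_exp]
  simpa only [nsmul_eq_mul, mul_neg, mul_one] using h

/-- **The dyadic congruences of `X` at `𝔭₂`**: `A + 2 ∈ 𝔭₂⁴`, `B' = A² - 4B ∈ 𝔭₂¹⁷`, `B - 1 ∈ 𝔭₂³` (certificates: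
the `2`-adic residue maps `𝓞 K → ℤ/16, ℤ/2¹⁸, ℤ/8` with `γ ↦ 4, 73668, 4`). [cite: SilvermanAEC2009, Example X.4.10] -/
theorem dyadic_congruences_X (hγ : γ ^ 3 - γ ^ 2 + 27 * γ + 36 = 0) (h3 : finrank ℚ K = 3) (ψ₁ : 𝓞 K →+* ZMod 2)
    (v : HeightOneSpectrum (𝓞 K)) (hv : RingHom.ker ψ₁ = v.asIdeal) :
    (((76 : ℤ) : 𝓞 K) + (-228 : ℤ) * thetaInt (aeval_eq hγ) + (-219 : ℤ) * thetaInt (delta_root hγ)) + 2 ∈ v.asIdeal ^ 4 ∧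
    (((-463078 : ℤ) : 𝓞 K) + (158036 : ℤ) * thetaInt (aeval_eq hγ) + (-88849 : ℤ) * thetaInt (delta_root hγ)) ∈ v.asIdeal ^ 17 ∧
    (((-152521 : ℤ) : 𝓞 K) + (-158036 : ℤ) * thetaInt (aeval_eq hγ) + (88849 : ℤ) * thetaInt (delta_root hγ)) - 1 ∈ v.asIdeal ^ 3 := by
  -- finite facts (before any local instance)
  have r4 : ((4 : ℤ) : ZMod (2 ^ 4)) ^ 3 + ((-1 : ℤ) : ZMod (2 ^ 4)) * ((4 : ℤ) : ZMod (2 ^ 4)) ^ 2 +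
      ((27 : ℤ) : ZMod (2 ^ 4)) * (4 : ℤ) + ((36 : ℤ) : ZMod (2 ^ 4)) = 0 := by decide
  have s4 : ((3 : ℕ) : ZMod (2 ^ 4)) * 11 = 1 := by decide
  have s4' : (11 : ZMod (2 ^ 4)) * 3 = 1 := by decide
  have d4 : (11 : ZMod (2 ^ 4)) * (((4 : ℤ) : ZMod (2 ^ 4)) ^ 2 - ((4 : ℤ) : ZMod (2 ^ 4)) + 18) = 10 := by decide
  have c4 : ZMod.castHom (dvd_pow_self 2 (by omega : (4 : ℕ) ≠ 0)) (ZMod 2) ((4 : ℤ) : ZMod (2 ^ 4)) = 0 := by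
    rw [map_intCast]; decide
  have eA4 : ((76 : ℤ) : ZMod (2 ^ 4)) + ((-228 : ℤ) : ZMod (2 ^ 4)) * (4 : ℤ) + ((-219 : ℤ) : ZMod (2 ^ 4)) * 10 + 2
      = 0 := by decide
  have r18 : ((73668 : ℤ) : ZMod (2 ^ 18)) ^ 3 + ((-1 : ℤ) : ZMod (2 ^ 18)) * ((73668 : ℤ) : ZMod (2 ^ 18)) ^ 2 +
      ((27 : ℤ) : ZMod (2 ^ 18)) * (73668 : ℤ) + ((36 : ℤ) : ZMod (2 ^ 18)) = 0 := by decide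
  have s18 : ((3 : ℕ) : ZMod (2 ^ 18)) * 174763 = 1 := by decide
  have s18' : (174763 : ZMod (2 ^ 18)) * 3 = 1 := by decide
  have d18 : (174763 : ZMod (2 ^ 18)) * (((73668 : ℤ) : ZMod (2 ^ 18)) ^ 2 - ((73668 : ℤ) : ZMod (2 ^ 18)) + 18) =
      173258 := by decide
  have c18 : ZMod.castHom (dvd_pow_self 2 (by omega : (18 : ℕ) ≠ 0)) (ZMod 2) ((73668 : ℤ) : ZMod (2 ^ 18)) = 0 := by
    rw [map_intCast]; decide
  have eB18 : ((-463078 : ℤ) : ZMod (2 ^ 18)) + ((158036 : ℤ) : ZMod (2 ^ 18)) * (73668 : ℤ) +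
      ((-88849 : ℤ) : ZMod (2 ^ 18)) * 173258 = 0 := by decide
  have r3 : ((4 : ℤ) : ZMod (2 ^ 3)) ^ 3 + ((-1 : ℤ) : ZMod (2 ^ 3)) * ((4 : ℤ) : ZMod (2 ^ 3)) ^ 2 +
      ((27 : ℤ) : ZMod (2 ^ 3)) * (4 : ℤ) + ((36 : ℤ) : ZMod (2 ^ 3)) = 0 := by decide
  have s3 : ((3 : ℕ) : ZMod (2 ^ 3)) * 3 = 1 := by decide
  have s3' : (3 : ZMod (2 ^ 3)) * 3 = 1 := by decide
  have d3 : (3 : ZMod (2 ^ 3)) * (((4 : ℤ) : ZMod (2 ^ 3)) ^ 2 - ((4 : ℤ) : ZMod (2 ^ 3)) + 18) = 2 := by decide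
  have c3 : ZMod.castHom (dvd_pow_self 2 (by omega : (3 : ℕ) ≠ 0)) (ZMod 2) ((4 : ℤ) : ZMod (2 ^ 3)) = 0 := by
    rw [map_intCast]; decide
  have eB3 : ((-152521 : ℤ) : ZMod (2 ^ 3)) + ((-158036 : ℤ) : ZMod (2 ^ 3)) * (4 : ℤ) +
      ((88849 : ℤ) : ZMod (2 ^ 3)) * 2 - 1 = 0 := by decide
  have hψ₁γ := psi_two_gamma hγ ψ₁
  refine ⟨?_, ?_, ?_⟩
  · obtain ⟨ψ4, h4γ, h4δ3⟩ := exists_residueHom_two_pow hγ h3 4 4 r4 11 s4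
    have h4δ : ψ4 (thetaInt (delta_root hγ)) = 10 := by
      have h := congrArg (fun t => (11 : ZMod (2 ^ 4)) * t) h4δ3
      rw [← mul_assoc, s4', one_mul, d4] at h; exact h
    have hker4 := ker_eq_pow_p2 hγ h3 (k := 4) (by norm_num) ψ4 (by rw [h4γ]; exact c4) ψ₁ hψ₁γ
    rw [← hv, ← hker4, RingHom.mem_ker]
    simp only [map_add, map_mul, map_intCast, map_ofNat, h4γ, h4δ]; exact eA4
  · obtain ⟨ψ18, h18γ, h18δ3⟩ := exists_residueHom_two_pow hγ h3 18 73668 r18 174763 s18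
    have h18δ : ψ18 (thetaInt (delta_root hγ)) = 173258 := by
      have h := congrArg (fun t => (174763 : ZMod (2 ^ 18)) * t) h18δ3
      rw [← mul_assoc, s18', one_mul, d18] at h; exact h
    have hker18 := ker_eq_pow_p2 hγ h3 (k := 18) (by norm_num) ψ18 (by rw [h18γ]; exact c18) ψ₁ hψ₁γ
    refine Ideal.pow_le_pow_right (by norm_num : 17 ≤ 18) ?_
    rw [← hv, ← hker18, RingHom.mem_ker]
    simp only [map_add, map_mul, map_intCast, h18γ, h18δ]; exact eB18
  · obtain ⟨ψ3, h3γ, h3δ3⟩ := exists_residueHom_two_pow hγ h3 3 4 r3 3 s3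
    have h3δ : ψ3 (thetaInt (delta_root hγ)) = 2 := by
      have h := congrArg (fun t => (3 : ZMod (2 ^ 3)) * t) h3δ3
      rw [← mul_assoc, s3', one_mul, d3] at h; exact h
    have hker3 := ker_eq_pow_p2 hγ h3 (k := 3) (by norm_num) ψ3 (by rw [h3γ]; exact c3) ψ₁ hψ₁γ
    rw [← hv, ← hker3, RingHom.mem_ker]
    simp only [map_sub, map_add, map_mul, map_intCast, map_one, h3γ, h3δ]; exact eB3

/-! ## §2 The local condition at `𝔭₂` as a congruence modulo `𝔭₂^N` -/

/-- From `[a] = [b]` in `Lˣ/Lˣ²` (`a, b ≠ 0`): `a b` is a square. [cite: SilvermanAEC2009, Prop. X.4.9] -/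
private theorem exists_mul_eq_sq_of_sqClass_eq' {L : Type*} [Field L] {a b : L} (ha : a ≠ 0) (hb : b ≠ 0)
    (h : sqClass a = sqClass b) : ∃ z : L, a * b = z ^ 2 := by
  have h1 : sqClass (a * b) = 1 := by rw [sqClass_mul ha hb, h, SqUnits.mul_self]
  exact (sqClass_eq_one_iff (mul_ne_zero ha hb)).mp h1

/-- **The local condition of `S^{(φ̂)}` at `𝔭₂` as a congruence**: if `d ∈ 𝓞 K` has `[d]_{𝔭₂} ∈ α(X(K_{𝔭₂}))`
then for every `N ≥ 1` there are `j` (`2j = ord_{𝔭₂} d`), `a ∉ 𝔭₂`, `b` with `d a² - 4^j (1 + 8b) ∈ 𝔭₂^N`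
(the image is in `(1 + 8 O)K_vˣ²` by the dyadic lemma, then density). [cite: SilvermanAEC2009, Example X.4.10] -/
theorem exists_sq_congr_p2_of_local (hγ : γ ^ 3 - γ ^ 2 + 27 * γ + 36 = 0) (h3 : finrank ℚ K = 3)
    (ψ₁ : 𝓞 K →+* ZMod 2) (v : HeightOneSpectrum (𝓞 K)) (hv : RingHom.ker ψ₁ = v.asIdeal) {N : ℕ} (hN : 1 ≤ N)
    {d : 𝓞 K} (hd : d ≠ 0)
    (hloc : sqClass (algebraMap K (v.adicCompletion K) (algebraMap (𝓞 K) K d)) ∈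
      Set.range ((⟨0, -73 * γ ^ 2 - 155 * γ - 1238, 0, (88849 * γ ^ 2 - 562957 * γ + 1141719) / 3, 0⟩ :
        WeierstrassCurve K).baseChange (v.adicCompletion K)).xSqClass) :
    ∃ (j : ℕ) (a b : 𝓞 K), a ∉ v.asIdeal ∧ d * a ^ 2 - 4 ^ j * (1 + 8 * b) ∈ v.asIdeal ^ N := by
  have hval : ∀ y : K, Valued.v (algebraMap K (v.adicCompletion K) y) = v.valuation K y := fun y =>
    HeightOneSpectrum.valuedAdicCompletion_eq_valuation' v y
  have h2 := log_valuation_p2_two hγ h3 ψ₁ v hv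
  have hv2 : Valued.v (2 : v.adicCompletion K) = WithZero.exp (-1) := by
    rw [← map_ofNat (algebraMap K (v.adicCompletion K)) 2, hval]; exact h2
  have h20 : (2 : v.adicCompletion K) ≠ 0 := fun h0 => by
    rw [h0, map_zero] at hv2; exact WithZero.coe_ne_zero hv2.symm
  have hv2lt : Valued.v (2 : v.adicCompletion K) < 1 := by
    rw [hv2, ← WithZero.exp_zero, WithZero.exp_lt_exp]; norm_num
  obtain ⟨hA2, hBp17, hB1⟩ := dyadic_congruences_X hγ h3 ψ₁ v hv
  have ha2 : ((⟨0, -73 * γ ^ 2 - 155 * γ - 1238, 0, (88849 * γ ^ 2 - 562957 * γ + 1141719) / 3, 0⟩ :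
      WeierstrassCurve K).baseChange (v.adicCompletion K)).a₂ =
      algebraMap K (v.adicCompletion K) (((((76 : ℤ) : 𝓞 K) + (-228 : ℤ) * thetaInt (aeval_eq hγ) + (-219 : ℤ) * thetaInt (delta_root hγ)) : 𝓞 K) : K) := by
    rw [RingOfIntegers.coe_eq_algebraMap, coe_Aint hγ]; rfl
  have ha4 : ((⟨0, -73 * γ ^ 2 - 155 * γ - 1238, 0, (88849 * γ ^ 2 - 562957 * γ + 1141719) / 3, 0⟩ :
      WeierstrassCurve K).baseChange (v.adicCompletion K)).a₄ =
      algebraMap K (v.adicCompletion K) (((((-152521 : ℤ) : 𝓞 K) + (-158036 : ℤ) * thetaInt (aeval_eq hγ) + (88849 : ℤ) * thetaInt (delta_root hγ)) : 𝓞 K) : K) := by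
    rw [RingOfIntegers.coe_eq_algebraMap, coe_Bint hγ]; rfl
  have hA : Valued.v (((⟨0, -73 * γ ^ 2 - 155 * γ - 1238, 0, (88849 * γ ^ 2 - 562957 * γ + 1141719) / 3, 0⟩ :
      WeierstrassCurve K).baseChange (v.adicCompletion K)).a₂ + 2) ≤ Valued.v ((2 : v.adicCompletion K) ^ 4) := by
    have e : ((⟨0, -73 * γ ^ 2 - 155 * γ - 1238, 0, (88849 * γ ^ 2 - 562957 * γ + 1141719) / 3, 0⟩ :
        WeierstrassCurve K).baseChange (v.adicCompletion K)).a₂ + 2 =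
        algebraMap K (v.adicCompletion K) ((((((76 : ℤ) : 𝓞 K) + (-228 : ℤ) * thetaInt (aeval_eq hγ) + (-219 : ℤ) * thetaInt (delta_root hγ)) + 2 : 𝓞 K)) : K) := by
      rw [ha2]; push_cast; simp only [map_ofNat]
    rw [e]; exact valued_le_of_mem_p2_pow hγ h3 ψ₁ v hv hA2
  have hD : Valued.v (((⟨0, -73 * γ ^ 2 - 155 * γ - 1238, 0, (88849 * γ ^ 2 - 562957 * γ + 1141719) / 3, 0⟩ :
      WeierstrassCurve K).baseChange (v.adicCompletion K)).a₂ ^ 2 - 4 *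
      ((⟨0, -73 * γ ^ 2 - 155 * γ - 1238, 0, (88849 * γ ^ 2 - 562957 * γ + 1141719) / 3, 0⟩ :
      WeierstrassCurve K).baseChange (v.adicCompletion K)).a₄) ≤ Valued.v ((2 : v.adicCompletion K) ^ 17) := by
    have e : ((⟨0, -73 * γ ^ 2 - 155 * γ - 1238, 0, (88849 * γ ^ 2 - 562957 * γ + 1141719) / 3, 0⟩ :
        WeierstrassCurve K).baseChange (v.adicCompletion K)).a₂ ^ 2 - 4 *
        ((⟨0, -73 * γ ^ 2 - 155 * γ - 1238, 0, (88849 * γ ^ 2 - 562957 * γ + 1141719) / 3, 0⟩ :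
        WeierstrassCurve K).baseChange (v.adicCompletion K)).a₄ =
        algebraMap K (v.adicCompletion K) (((((-463078 : ℤ) : 𝓞 K) + (158036 : ℤ) * thetaInt (aeval_eq hγ) + (-88849 : ℤ) * thetaInt (delta_root hγ)) : 𝓞 K) : K) := by
      rw [ha2, ha4, RingOfIntegers.coe_eq_algebraMap, RingOfIntegers.coe_eq_algebraMap,
        RingOfIntegers.coe_eq_algebraMap, coe_Aint hγ, coe_Bint hγ, coe_Bpint hγ, ← sq_sub_four_mul_eq hγ]
      simp only [map_sub, map_pow, map_mul, map_add, map_neg, map_ofNat, map_div₀]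
    rw [e]; exact valued_le_of_mem_p2_pow hγ h3 ψ₁ v hv hBp17
  have hB : Valued.v (((⟨0, -73 * γ ^ 2 - 155 * γ - 1238, 0, (88849 * γ ^ 2 - 562957 * γ + 1141719) / 3, 0⟩ :
      WeierstrassCurve K).baseChange (v.adicCompletion K)).a₄ - 1) ≤ Valued.v ((2 : v.adicCompletion K) ^ 3) := by
    have e : ((⟨0, -73 * γ ^ 2 - 155 * γ - 1238, 0, (88849 * γ ^ 2 - 562957 * γ + 1141719) / 3, 0⟩ :
        WeierstrassCurve K).baseChange (v.adicCompletion K)).a₄ - 1 =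
        algebraMap K (v.adicCompletion K) ((((((-152521 : ℤ) : 𝓞 K) + (-158036 : ℤ) * thetaInt (aeval_eq hγ) + (88849 : ℤ) * thetaInt (delta_root hγ)) - 1 : 𝓞 K)) : K) := by
      rw [ha4]; push_cast; ring
    rw [e]; exact valued_le_of_mem_p2_pow hγ h3 ψ₁ v hv hB1
  obtain ⟨P, hP⟩ := hloc
  obtain ⟨m, hm, hPm⟩ := xSqClass_eq_sqClass_one_add_eight_mul h20 hv2lt hA hD hB P
  rw [hP] at hPm
  have hdL0 : algebraMap K (v.adicCompletion K) (algebraMap (𝓞 K) K d) ≠ 0 := by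
    rw [_root_.map_ne_zero, map_ne_zero_iff _ (IsFractionRing.injective (𝓞 K) K)]; exact hd
  have h18 : (1 + 8 * m : v.adicCompletion K) ≠ 0 := by
    intro h0
    have h1 : Valued.v (1 + 8 * m) = 1 := by
      rw [Valuation.map_add_eq_of_lt_left _ ?_, map_one]
      rw [map_one, map_mul, show (8 : v.adicCompletion K) = 2 ^ 3 by norm_num, map_pow]
      calc Valued.v (2 : v.adicCompletion K) ^ 3 * Valued.v m ≤ Valued.v (2 : v.adicCompletion K) ^ 3 * 1 := by
            gcongr
        _ < 1 := by rw [mul_one]; exact pow_lt_one₀ zero_le hv2lt three_ne_zero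
    rw [h0, map_zero] at h1; exact zero_ne_one h1
  obtain ⟨z, hz⟩ := exists_mul_eq_sq_of_sqClass_eq' hdL0 h18 hPm
  have hz0 : z ≠ 0 := by rintro rfl; exact mul_ne_zero hdL0 h18 (by rw [hz]; ring)
  -- `d t² = 1 + 8m` with `t = (1 + 8m)/z`
  refine exists_sq_congr_of_mul_sq_eq_one_add v h2 hN d (t := (1 + 8 * m) / z)
    (div_ne_zero h18 hz0) hm ?_
  rw [RingOfIntegers.coe_eq_algebraMap]
  field_simp
  linear_combination hz

/-! ## §3 The arithmetic criterion in `ℤ/2^N` -/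

/-- **The `𝔭₂`-criterion of the `φ̂`-side.** Let `ψ : 𝓞 K → ℤ/2^N` (`N ≥ 1`) be the `2`-adic residue map with
`ψ(γ) = r` even (`ker ψ = 𝔭₂^N`). If `d ∈ 𝓞 K`, `d ≠ 0`, has `[d]_{𝔭₂} ∈ α(X(K_{𝔭₂}))`, then
`ψ(d) ≡ 4^j (mod 2^{min(2j+3, N)})` for some `j`. [cite: SilvermanAEC2009, Example X.4.10] -/
theorem val_mod_p2_of_local (hγ : γ ^ 3 - γ ^ 2 + 27 * γ + 36 = 0) (h3 : finrank ℚ K = 3)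
    (ψ₁ : 𝓞 K →+* ZMod 2) (v : HeightOneSpectrum (𝓞 K)) (hv : RingHom.ker ψ₁ = v.asIdeal) {N : ℕ} (hN : 1 ≤ N)
    (ψ : 𝓞 K →+* ZMod (2 ^ N))
    (hψ : ZMod.castHom (dvd_pow_self 2 (by omega : N ≠ 0)) (ZMod 2) (ψ (thetaInt (aeval_eq hγ))) = 0)
    {d : 𝓞 K} (hd : d ≠ 0)
    (hloc : sqClass (algebraMap K (v.adicCompletion K) (algebraMap (𝓞 K) K d)) ∈
      Set.range ((⟨0, -73 * γ ^ 2 - 155 * γ - 1238, 0, (88849 * γ ^ 2 - 562957 * γ + 1141719) / 3, 0⟩ :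
        WeierstrassCurve K).baseChange (v.adicCompletion K)).xSqClass) :
    ∃ j : ℕ, (ψ d).val % 2 ^ min (2 * j + 3) N = 4 ^ j % 2 ^ min (2 * j + 3) N := by
  haveI : NeZero (2 ^ N) := ⟨pow_ne_zero N two_ne_zero⟩
  have hψ₁γ := psi_two_gamma hγ ψ₁
  have hker := ker_eq_pow_p2 hγ h3 hN ψ hψ ψ₁ hψ₁γ
  -- `ψ₁ = (mod 2) ∘ ψ`
  have hcomp : (ZMod.castHom (dvd_pow_self 2 (by omega : N ≠ 0)) (ZMod 2)).comp ψ = ψ₁ :=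
    MonicCubic.residueHom_unique (aeval_eq hγ) (mem3 hγ h3) (by norm_num) _ _ (by rw [RingHom.comp_apply, hψ, hψ₁γ])
  obtain ⟨j, a, b, ha, hx⟩ := exists_sq_congr_p2_of_local hγ h3 ψ₁ v hv hN hd hloc
  refine ⟨j, val_mod_eq_of_sq_congr v hN ψ (fun x hx' => ?_) (fun a' ha' => ?_) ha hx⟩
  · rw [← RingHom.mem_ker, hker, hv]; exact hx'
  · -- `a' ∉ 𝔭₂ ⇒ ψ a'` odd
    have h1 : ψ₁ a' ≠ 0 := by rw [Ne, ← RingHom.mem_ker, hv]; exact ha'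
    rw [← hcomp, RingHom.comp_apply] at h1
    have h2 : ((ψ a').val : ZMod 2) ≠ 0 := by
      rw [ZMod.natCast_val]; rwa [ZMod.castHom_apply] at h1
    have h3' : (ψ a').val % 2 ≠ 0 := by
      intro h0; apply h2; rw [← ZMod.natCast_mod, h0, Nat.cast_zero]
    omega

end KubertTate289Cubic

end Literature.NumberTheory.EllipticCurves

end
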